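import Mathlib
import Summits.CriticalPhenomena.CardyFormulaZ2.Theorems.CardySelfRefinementGradientComparabilityStubLevelSetTransportLeaf
import HarnessLib

/-!
# Level-set transport of the gradient: continuation of corner leaves (pure analysis)

Crux `stmt-CriticalPhenomena-10269`
(`Summit.CriticalPhenomena.CardyFormulaZ2.Theses.CardySelfRefinement.GradientComparability`),
line **monotone-product-coordinates**, support for stub `stub_levelSetTransport`; sequel of
`…StubLevelSetTransportLeaf` (notation as there: `Φ_ρ q = fderiv ℝ Φ q (1,0)`,
`Φ_c q = fderiv ℝ Φ q (0,1)`).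

For a `C²` function `Φ` on a strip `[ρlo, 1] × [c-range]` with `Φ_c ≥ 0` and
`|∂_ρ(Φ_c/Φ_ρ)| ≤ Θ` at the level-`v` points, a level-`v` point `q₀` with `Φ_ρ q₀ ≠ 0` is joined
INSIDE ITS LEVEL SET to a point of the edge `ρ = 1` or of the far `c`-edge, along a leaf on which
`ρ` does not decrease and `log |Φ_ρ|` is `Θ`-Lipschitz in `c` (twin identity
`d/dc log|Φ_ρ| = ∂_ρ(Φ_c/Φ_ρ)`):

* `corner_leaf_transport` — `Φ_ρ q₀ < 0`, leaf followed upwards in `c` (maximality argument on the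
  compact set of level points obeying the multiplicative bound, pushed by `corner_leaf_local`);
* `corner_leaf_transport_down` — `Φ_ρ q₀ > 0`, downwards (reflection `c ↦ -c`);
* `corner_endpoint` — both cases on the strip `[ρlo,1] × [0,1]` when the top edge `c = 1` carries
  no level point: the endpoint lies on the slices `{ρ = 1} ∪ {c = 0}` and `|Φ_ρ|` there is
  `e^Θ`-comparable to `|Φ_ρ q₀|`.
-/

noncomputable section

namespace Summit.CriticalPhenomena.CardyFormulaZ2.Theorems.CardySelfRefinement

open scoped Topology
open Filter Set

/-- **Corner leaf transport (upwards).**  Let `Ψ` be `C²`, `0 < ρlo`, and on the strip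
`[ρlo, 1] × [c₀, cb]` (`c₀ = q₀.2`): `Ψ_c ≥ 0` (on `[0,1] × [c₀,cb]`), and `|∂_ρ(Ψ_c/Ψ_ρ)| ≤ Θ` at
every level-`v` point.  Then from every level-`v` point `q₀` of the strip with `Ψ_ρ q₀ < 0` the
level set reaches a point `e` of the strip on the edge `ρ = 1` or on the top `c = cb`, with
`|log(-Ψ_ρ e) - log(-Ψ_ρ q₀)| ≤ Θ (e.2 - q₀.2)` (stated multiplicatively).  Proof: among the
level points of the strip above `q₀` obeying the multiplicative bound — a compact set — take one
with maximal `c`; were it inside, `corner_leaf_local` would push further. -/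
theorem corner_leaf_transport {Ψ : ℝ × ℝ → ℝ} (hΨ : ContDiff ℝ 2 Ψ) {ρlo cb v Θ : ℝ}
    {q₀ : ℝ × ℝ} (hρlo : 0 < ρlo) (hq₀ρ : q₀.1 ∈ Set.Icc ρlo 1) (hq₀c : q₀.2 ≤ cb)
    (hq₀v : Ψ q₀ = v) (hneg : fderiv ℝ Ψ q₀ (1, 0) < 0)
    (hcnn : ∀ q : ℝ × ℝ, q.1 ∈ Set.Icc (0 : ℝ) 1 → q.2 ∈ Set.Icc q₀.2 cb →
      0 ≤ fderiv ℝ Ψ q (0, 1))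
    (hS : ∀ q : ℝ × ℝ, q.1 ∈ Set.Icc ρlo 1 → q.2 ∈ Set.Icc q₀.2 cb → Ψ q = v → ∀ S' : ℝ,
      HasDerivAt (fun r => fderiv ℝ Ψ (r, q.2) (0, 1) / fderiv ℝ Ψ (r, q.2) (1, 0)) S' q.1 →
        |S'| ≤ Θ) :
    ∃ e : ℝ × ℝ, e.1 ∈ Set.Icc ρlo 1 ∧ e.2 ∈ Set.Icc q₀.2 cb ∧ (e.1 = 1 ∨ e.2 = cb) ∧ Ψ e = v ∧
      -fderiv ℝ Ψ e (1, 0) ≤ Real.exp (Θ * (e.2 - q₀.2)) * -fderiv ℝ Ψ q₀ (1, 0) ∧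
      -fderiv ℝ Ψ q₀ (1, 0) ≤ Real.exp (Θ * (e.2 - q₀.2)) * -fderiv ℝ Ψ e (1, 0) := by
  set a₀ : ℝ := -fderiv ℝ Ψ q₀ (1, 0) with ha₀
  have ha₀pos : 0 < a₀ := by simp only [ha₀]; linarith
  set K : Set (ℝ × ℝ) := {q | q.1 ∈ Set.Icc ρlo 1 ∧ q.2 ∈ Set.Icc q₀.2 cb ∧ Ψ q = v ∧
      -fderiv ℝ Ψ q (1, 0) ≤ Real.exp (Θ * (q.2 - q₀.2)) * a₀ ∧
      a₀ ≤ Real.exp (Θ * (q.2 - q₀.2)) * -fderiv ℝ Ψ q (1, 0)} with hK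
  have hF : Continuous fun q : ℝ × ℝ => -fderiv ℝ Ψ q (1, 0) :=
    ((hΨ.continuous_fderiv (by norm_num)).clm_apply continuous_const).neg
  have hE : Continuous fun q : ℝ × ℝ => Real.exp (Θ * (q.2 - q₀.2)) := by fun_prop
  have hKcl : IsClosed K := by
    simp only [hK, Set.setOf_and]
    refine ((isClosed_Icc.preimage continuous_fst).inter
      ((isClosed_Icc.preimage continuous_snd).inter ((isClosed_eq hΨ.continuous
        continuous_const).inter ((isClosed_le hF (hE.mul continuous_const)).inter
          (isClosed_le continuous_const (hE.mul hF))))))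
  have hKc : IsCompact K :=
    (isCompact_Icc.prod isCompact_Icc).of_isClosed_subset hKcl fun q hq => ⟨hq.1, hq.2.1⟩
  have hq₀K : q₀ ∈ K := by
    refine ⟨hq₀ρ, ⟨le_rfl, hq₀c⟩, hq₀v, ?_, ?_⟩ <;> simp [ha₀]
  obtain ⟨e, heK, hmax⟩ := hKc.exists_isMaxOn ⟨q₀, hq₀K⟩ continuous_snd.continuousOn
  obtain ⟨heρ, hec, hev, he1, he2⟩ := heK
  refine ⟨e, heρ, hec, ?_, hev, he1, he2⟩
  by_contra hne
  rw [not_or] at hne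
  have hneg_e : fderiv ℝ Ψ e (1, 0) < 0 := by
    have hE0 : 0 < Real.exp (Θ * (e.2 - q₀.2)) := Real.exp_pos _
    by_contra hge
    rw [not_lt] at hge
    have : Real.exp (Θ * (e.2 - q₀.2)) * -fderiv ℝ Ψ e (1, 0) ≤ 0 :=
      mul_nonpos_of_nonneg_of_nonpos hE0.le (by linarith)
    linarith
  obtain ⟨q, hqρ, hqc, hqv, hq1, hq2⟩ := corner_leaf_local hΨ hρlo
    ⟨heρ.1, lt_of_le_of_ne heρ.2 hne.1⟩ ⟨hec.1, lt_of_le_of_ne hec.2 hne.2⟩ hev hneg_e hcnn hS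
  have hexp : Real.exp (Θ * (q.2 - e.2)) * Real.exp (Θ * (e.2 - q₀.2)) =
      Real.exp (Θ * (q.2 - q₀.2)) := by
    rw [← Real.exp_add]; ring_nf
  have hqK : q ∈ K := by
    refine ⟨hqρ, ⟨hec.1.trans hqc.1.le, hqc.2⟩, hqv, ?_, ?_⟩
    · calc -fderiv ℝ Ψ q (1, 0) ≤ Real.exp (Θ * (q.2 - e.2)) * -fderiv ℝ Ψ e (1, 0) := hq1
        _ ≤ Real.exp (Θ * (q.2 - e.2)) * (Real.exp (Θ * (e.2 - q₀.2)) * a₀) :=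
          mul_le_mul_of_nonneg_left he1 (Real.exp_pos _).le
        _ = Real.exp (Θ * (q.2 - q₀.2)) * a₀ := by rw [← mul_assoc, hexp]
    · calc a₀ ≤ Real.exp (Θ * (e.2 - q₀.2)) * -fderiv ℝ Ψ e (1, 0) := he2
        _ ≤ Real.exp (Θ * (e.2 - q₀.2)) * (Real.exp (Θ * (q.2 - e.2)) * -fderiv ℝ Ψ q (1, 0)) :=
          mul_le_mul_of_nonneg_left hq2 (Real.exp_pos _).le
        _ = Real.exp (Θ * (q.2 - q₀.2)) * -fderiv ℝ Ψ q (1, 0) := by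
          rw [← mul_assoc, mul_comm (Real.exp (Θ * (e.2 - q₀.2))), hexp]
  have hle : q.2 ≤ e.2 := hmax hqK
  linarith [hqc.1]

/-- **Corner leaf transport (downwards)** — the mirror image of `corner_leaf_transport` for a
start point with `Φ_ρ q₀ > 0`: the leaf is followed DOWN in `c` to the edge `ρ = 1` or the bottom
`c = ca` (apply `corner_leaf_transport` to the reflection `Ψ(ρ,c) = -Φ(ρ,-c)`, which has
`Ψ_ρ = -Φ_ρ`, `Ψ_c = Φ_c ∘ refl ≥ 0` and the same `|∂_ρ(Ψ_c/Ψ_ρ)|`). -/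
theorem corner_leaf_transport_down {Φ : ℝ × ℝ → ℝ} (hΦ : ContDiff ℝ 2 Φ) {ρlo ca v Θ : ℝ}
    {q₀ : ℝ × ℝ} (hρlo : 0 < ρlo) (hq₀ρ : q₀.1 ∈ Set.Icc ρlo 1) (hq₀c : ca ≤ q₀.2)
    (hq₀v : Φ q₀ = v) (hposρ : 0 < fderiv ℝ Φ q₀ (1, 0))
    (hcnn : ∀ q : ℝ × ℝ, q.1 ∈ Set.Icc (0 : ℝ) 1 → q.2 ∈ Set.Icc ca q₀.2 →
      0 ≤ fderiv ℝ Φ q (0, 1))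
    (hS : ∀ q : ℝ × ℝ, q.1 ∈ Set.Icc ρlo 1 → q.2 ∈ Set.Icc ca q₀.2 → Φ q = v → ∀ S' : ℝ,
      HasDerivAt (fun r => fderiv ℝ Φ (r, q.2) (0, 1) / fderiv ℝ Φ (r, q.2) (1, 0)) S' q.1 →
        |S'| ≤ Θ) :
    ∃ e : ℝ × ℝ, e.1 ∈ Set.Icc ρlo 1 ∧ e.2 ∈ Set.Icc ca q₀.2 ∧ (e.1 = 1 ∨ e.2 = ca) ∧ Φ e = v ∧
      fderiv ℝ Φ e (1, 0) ≤ Real.exp (Θ * (q₀.2 - e.2)) * fderiv ℝ Φ q₀ (1, 0) ∧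
      fderiv ℝ Φ q₀ (1, 0) ≤ Real.exp (Θ * (q₀.2 - e.2)) * fderiv ℝ Φ e (1, 0) := by
  -- the reflection `c ↦ -c`
  set L : (ℝ × ℝ) →L[ℝ] (ℝ × ℝ) :=
    (ContinuousLinearMap.fst ℝ ℝ ℝ).prod (-ContinuousLinearMap.snd ℝ ℝ ℝ) with hL
  have hLapply : ∀ q : ℝ × ℝ, L q = (q.1, -q.2) := fun q => rfl
  set Ψ : ℝ × ℝ → ℝ := fun q => -Φ (L q) with hΨdef
  have hΨ : ContDiff ℝ 2 Ψ := (hΦ.comp L.contDiff).neg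
  have hfd : ∀ q : ℝ × ℝ, fderiv ℝ Ψ q = -((fderiv ℝ Φ (L q)).comp L) := fun q =>
    (((hΦ.differentiable (by norm_num)) (L q)).hasFDerivAt.comp q L.hasFDerivAt).neg.fderiv
  have hρ' : ∀ q : ℝ × ℝ, fderiv ℝ Ψ q (1, 0) = -fderiv ℝ Φ (q.1, -q.2) (1, 0) := by
    intro q
    rw [hfd]
    simp [hLapply]
  have hc' : ∀ q : ℝ × ℝ, fderiv ℝ Ψ q (0, 1) = fderiv ℝ Φ (q.1, -q.2) (0, 1) := by
    intro q
    rw [hfd]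
    have h1 : L (0, 1) = -((0 : ℝ), (1 : ℝ)) := by simp [hLapply]
    show -(fderiv ℝ Φ (L q) (L (0, 1))) = _
    rw [h1, map_neg, neg_neg, hLapply]
  -- hypotheses of the upward transport for `Ψ`
  have hcnn' : ∀ q : ℝ × ℝ, q.1 ∈ Set.Icc (0 : ℝ) 1 → q.2 ∈ Set.Icc (-q₀.2) (-ca) →
      0 ≤ fderiv ℝ Ψ q (0, 1) := by
    intro q hq1 hq2
    rw [hc']
    exact hcnn (q.1, -q.2) hq1 ⟨by linarith [hq2.2], by linarith [hq2.1]⟩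
  have hS' : ∀ q : ℝ × ℝ, q.1 ∈ Set.Icc ρlo 1 → q.2 ∈ Set.Icc (-q₀.2) (-ca) → Ψ q = -v →
      ∀ S' : ℝ, HasDerivAt (fun r => fderiv ℝ Ψ (r, q.2) (0, 1) / fderiv ℝ Ψ (r, q.2) (1, 0))
        S' q.1 → |S'| ≤ Θ := by
    intro q hq1 hq2 hqv S' hS'
    have hqv' : Φ (q.1, -q.2) = v := by
      simp only [hΨdef, hLapply] at hqv
      linarith
    have hder : HasDerivAt (fun r => fderiv ℝ Φ (r, -q.2) (0, 1) / fderiv ℝ Φ (r, -q.2) (1, 0))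
        (-S') q.1 := by
      refine hS'.neg.congr_of_eventuallyEq (Filter.Eventually.of_forall fun r => ?_)
      simp only [hρ', hc', Pi.neg_apply, div_neg, neg_neg]
    have h := hS (q.1, -q.2) hq1 ⟨by linarith [hq2.2], by linarith [hq2.1]⟩ hqv' (-S') hder
    rwa [abs_neg] at h
  obtain ⟨e, heρ, hec, hedge, hev, he1, he2⟩ := corner_leaf_transport hΨ (q₀ := (q₀.1, -q₀.2))
    hρlo hq₀ρ (neg_le_neg hq₀c) (by simp [hΨdef, hLapply, hq₀v])
    (by rw [hρ']; simpa using hposρ) hcnn' hS'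
  simp only at hec he1 he2
  rw [hρ', hρ', neg_neg, neg_neg] at he1 he2
  simp only [neg_neg, Prod.mk.eta] at he1 he2
  have hexp : Θ * (e.2 - -q₀.2) = Θ * (q₀.2 - -e.2) := by ring
  rw [hexp] at he1 he2
  refine ⟨(e.1, -e.2), heρ, ⟨by linarith [hec.2], by linarith [hec.1]⟩, ?_, ?_, he1, he2⟩
  · rcases hedge with h | h
    · exact Or.inl h
    · right
      show -e.2 = ca
      linarith
  · simp only [hΨdef, hLapply] at hev
    linarith

/-- **The endpoint of a corner leaf.**  Let `Φ` be `C²`, `0 < ρlo`, `Θ ≥ 0`; assume `Φ_c ≥ 0` on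
the unit square, `|∂_ρ(Φ_c/Φ_ρ)| ≤ Θ` at every level-`v` point of the strip `[ρlo,1] × [0,1]`, and
no level-`v` point on its top edge `c = 1`.  Then every level-`v` point `q₀` of the strip with
`Φ_ρ q₀ ≠ 0` is joined (inside its level set) to a level-`v` point `e` of the strip lying on the
slices `{ρ = 1} ∪ {c = 0}`, with `|Φ_ρ|` at `q₀` and at `e` comparable up to the factor `exp Θ`
(upwards leaf if `Φ_ρ q₀ < 0`, downwards leaf if `Φ_ρ q₀ > 0`). -/
theorem corner_endpoint {Φ : ℝ × ℝ → ℝ} (hΦ : ContDiff ℝ 2 Φ) {ρlo v Θ : ℝ} (hρlo : 0 < ρlo)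
    (hΘ : 0 ≤ Θ)
    (hcnn : ∀ q : ℝ × ℝ, q.1 ∈ Set.Icc (0 : ℝ) 1 → q.2 ∈ Set.Icc (0 : ℝ) 1 →
      0 ≤ fderiv ℝ Φ q (0, 1))
    (hS : ∀ q : ℝ × ℝ, q.1 ∈ Set.Icc ρlo 1 → q.2 ∈ Set.Icc (0 : ℝ) 1 → Φ q = v → ∀ S' : ℝ,
      HasDerivAt (fun r => fderiv ℝ Φ (r, q.2) (0, 1) / fderiv ℝ Φ (r, q.2) (1, 0)) S' q.1 →
        |S'| ≤ Θ)
    (htop : ∀ ρ ∈ Set.Icc ρlo 1, Φ (ρ, 1) ≠ v)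
    {q₀ : ℝ × ℝ} (hq₀ρ : q₀.1 ∈ Set.Icc ρlo 1) (hq₀c : q₀.2 ∈ Set.Icc (0 : ℝ) 1)
    (hq₀v : Φ q₀ = v) (hne : fderiv ℝ Φ q₀ (1, 0) ≠ 0) :
    ∃ e : ℝ × ℝ, e.1 ∈ Set.Icc ρlo 1 ∧ e.2 ∈ Set.Icc (0 : ℝ) 1 ∧ (e.1 = 1 ∨ e.2 = 0) ∧
      Φ e = v ∧ |fderiv ℝ Φ q₀ (1, 0)| ≤ Real.exp Θ * |fderiv ℝ Φ e (1, 0)| ∧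
      |fderiv ℝ Φ e (1, 0)| ≤ Real.exp Θ * |fderiv ℝ Φ q₀ (1, 0)| := by
  rcases lt_or_gt_of_ne hne with hlt | hgt
  · -- `Φ_ρ q₀ < 0`: follow the leaf upwards; it cannot end on the top edge
    obtain ⟨e, heρ, hec, hedge, hev, he1, he2⟩ := corner_leaf_transport hΦ (cb := 1) hρlo hq₀ρ
      hq₀c.2 hq₀v hlt (fun q h1 h2 => hcnn q h1 ⟨hq₀c.1.trans h2.1, h2.2⟩)
      (fun q h1 h2 => hS q h1 ⟨hq₀c.1.trans h2.1, h2.2⟩)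
    have he1' : e.1 = 1 := by
      rcases hedge with h | h
      · exact h
      · exact absurd (by rw [← h, Prod.mk.eta]; exact hev) (htop e.1 heρ)
    have hq : 0 < -fderiv ℝ Φ q₀ (1, 0) := by linarith
    have hepos : 0 < -fderiv ℝ Φ e (1, 0) := by
      by_contra h
      rw [not_lt] at h
      have := mul_nonpos_of_nonneg_of_nonpos (Real.exp_pos (Θ * (e.2 - q₀.2))).le h
      linarith
    have hexp : Real.exp (Θ * (e.2 - q₀.2)) ≤ Real.exp Θ :=
      Real.exp_le_exp.2 (by nlinarith [hec.2, hq₀c.1])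
    refine ⟨e, heρ, ⟨hq₀c.1.trans hec.1, hec.2⟩, Or.inl he1', hev, ?_, ?_⟩
    · rw [abs_of_neg hlt, abs_of_neg (by linarith)]
      exact he2.trans (mul_le_mul_of_nonneg_right hexp hepos.le)
    · rw [abs_of_neg hlt, abs_of_neg (by linarith)]
      exact he1.trans (mul_le_mul_of_nonneg_right hexp hq.le)
  · -- `Φ_ρ q₀ > 0`: follow the leaf downwards to `c = 0` or `ρ = 1`
    obtain ⟨e, heρ, hec, hedge, hev, he1, he2⟩ := corner_leaf_transport_down hΦ (ca := 0) hρlo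
      hq₀ρ hq₀c.1 hq₀v hgt (fun q h1 h2 => hcnn q h1 ⟨h2.1, h2.2.trans hq₀c.2⟩)
      (fun q h1 h2 => hS q h1 ⟨h2.1, h2.2.trans hq₀c.2⟩)
    have hepos : 0 < fderiv ℝ Φ e (1, 0) := by
      by_contra h
      rw [not_lt] at h
      have := mul_nonpos_of_nonneg_of_nonpos (Real.exp_pos (Θ * (q₀.2 - e.2))).le h
      linarith
    have hexp : Real.exp (Θ * (q₀.2 - e.2)) ≤ Real.exp Θ :=
      Real.exp_le_exp.2 (by nlinarith [hec.1, hq₀c.2])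
    refine ⟨e, heρ, ⟨hec.1, hec.2.trans hq₀c.2⟩, hedge, hev, ?_, ?_⟩
    · rw [abs_of_pos hgt, abs_of_pos hepos]
      exact he2.trans (mul_le_mul_of_nonneg_right hexp hepos.le)
    · rw [abs_of_pos hgt, abs_of_pos hepos]
      exact he1.trans (mul_le_mul_of_nonneg_right hexp hgt.le)

end Summit.CriticalPhenomena.CardyFormulaZ2.Theorems.CardySelfRefinement

end
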